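import Literature.NumberTheory.Automorphic.ArchRankinSelbergGammaLocalGL2
import Literature.NumberTheory.Automorphic.ArchRankinSelbergTateFactorGL2
import HarnessLib

/-!
# The Gamma bookkeeping of the archimedean `GL₂ × GL₂` Rankin–Selberg integral over all places:
# `T(s) · M(s) = A c^s ∏ Γ_ℝ(s + a_j) ∏ Γ_ℂ(s + b_j)` for a pair of tagged test vectors
# (Humphries–Jo (2024), Thm. 5.6, Prop. 5.8; Jacquet (1972), §17–§19)

Topic `NumberTheory/Automorphic`; namespace `Literature.NumberTheory.Automorphic`. Theorems only (no
definition, no named fact, no instance). Companion of `ArchRankinSelbergGammaLocalGL2` (the local cancellations).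
In the Humphries–Jo route to `HumphriesJo2024_archRankinSelberg_testVector 2 K`
(`ArchRankinSelbergTestVectorRankTwoOfKAverage`: clause (i) ⇐ the `K_∞`-average Gamma identity `h`), once the
`K_∞`-average of `P(e₂k) W_{τ(k)e} conj W'_{τ'(k)e'}` has been evaluated by the reproducing kernel and the
`K₁`-average removed by the invariance of the Haar measure of `K_∞ˣ`, the identity `h` reads `T(s) · M(s) = …` with

* `T(s) = ∫_{K_∞ˣ} g(c) N(c)^{2s} dμ_c`, `g = ω conj ω' χ · e^{-π Σ|c_w|²}` the RADIAL Gaussian monomial of exponents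
  `p_w = 2(β(t_w) + conj β(t'_w))` at the real places and `q_w = 2(β(t_w) + conj β(t'_w)) - 2` at the complex ones
  (the degree `p + p'`, resp. `n + n'`, of the weight polynomial `P` plus the central exponents `μ + conj μ'`;
  Tate's factor `ArchRankinSelbergTateFactorGL2`);
* `M(s) = ∫ H(y' 0) N(y' 0)^{s-1} dμ_A'(y')` (`μ_A'` a Haar measure of `Fin 1 → K_∞ˣ`), `H = C ∏_w S_{t_w} conj S'_{t'_w}`
  the product of the two factorised Kirillov functions of the tagged test vectors `e, e'`
  (`ArchKirillovFactorisationGL2`, `ArchHeckeTestVectorConstructionGL2.realShapeOf/complexShapeOf`), `C ≠ 0`.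

Main result `rsGammaProduct_archRankinSelberg_tagged`: under the unitarity bounds on the parameters of the tags
(`ArchUnitarityBoundsGL2Real`: `re μ = 0`, `re κ = 0`, `|im ν| < ½`; `ArchUnitarityBoundsGL2Complex`: `re μ₁ = 0`,
`|im ν^a|, |im ν^h| < m/2 + 1`, `im ν^a = m/2` on strings), for ALL pairs of tags at every place,
**`T(s) · M(s) = A c^s ∏_j Γ_ℝ(s + a_j) ∏_j Γ_ℂ(s + b_j)` on `re s > 1` with `A ≠ 0`, `c > 0`,
`re a_j, re b_j > -1`** — the analytic half (R4) of the stub `stub_kAverageGammaGL2_of_reproducingKernel` of the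
crux `QuadraticBaseChangeGL2` (line Sketch): Tate's factor, the transport `(Fin 1 → K_∞ˣ) ≃ K_∞ˣ` of the Haar
measure, Fubini over the places (`integrable_and_integral_units_prod_mul_norm_cpow`), regrouping, and the
local bookkeeping in recursor form (`rsGammaProduct_local_realTagRec`, `rsGammaProduct_local_complexTagRec`:
the exponent `β(t)` is written as a `RealTag.rec` / `ComplexTag.rec` term, a closed term identical across
declarations). The constant `A` is absorbed downstream by rescaling `e` (`kirillovFn_smul`).

## References

* P. Humphries, Y. Jo, *Test vectors for archimedean period integrals*, Publ. Mat. 68 (2024), Thm. 5.6,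
  Prop. 5.8 [HumphriesJo2024].
* H. Jacquet, *Automorphic Forms on GL(2), Part II*, LNM 278 (1972), §17–§19 [Jacquet1972GL2II].
* J. Tate, *Fourier analysis in number fields and Hecke's zeta-functions* (1967), §2.5 [TateThesis1967].
-/

noncomputable section

open MeasureTheory Measure NumberField NumberField.InfinitePlace NumberField.mixedEmbedding IsDedekindDomain Set Filter
open scoped MatrixGroups ENNReal NNReal Classical ComplexConjugate

namespace Literature.NumberTheory.Automorphic

variable (K : Type) [Field K] [NumberField K]

/-! ### 1. The exponents of the tags as recursor terms

The exponent `β(t)` of a tag enters the statements below as the RECURSOR term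
`RealTag.rec (k ↦ (μ+k)/2) (κ ↦ (μ+1)/2) (μ/2) (μ/2+1) t` (resp. `ComplexTag.rec (b ↦ (μ₁+m+1)/2 + b)
(b ↦ (μ₁+m+1)/2 + b) (j ↦ (μ₁+m+1)/2) t`), a closed term identical across declarations (an inline `match` is a
per-declaration auxiliary), reducing to the exponent of `realShapeOf μ ν t` / `complexShapeOf μ₁ m ν^a ν^h t` on
each constructor. -/

/-- `re β(t) ≥ 0` for an admissible real tag with `re μ = 0`. [folklore] -/
theorem re_realTagExponentRec_nonneg (μ ν : ℂ) (t : RealTag) (hμ : μ.re = 0)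
    (ht : match t with
      | .discPlus k => 1 ≤ k
      | .weightOneSym κ => κ.re = 0
      | .weightZero => |ν.im| < 1 / 2
      | .weightZeroX => |ν.im| < 1 / 2) :
    0 ≤ (RealTag.rec (motive := fun _ => ℂ) (fun k => (μ + k) / 2) (fun _ => (μ + 1) / 2) (μ / 2) (μ / 2 + 1) t).re := by
  cases t with
  | discPlus k =>
    have hk : (0 : ℝ) ≤ k := Nat.cast_nonneg k
    simp only [Complex.div_ofNat_re, Complex.add_re, Complex.natCast_re, hμ]
    linarith
  | weightOneSym κ =>
    simp only [Complex.div_ofNat_re, Complex.add_re, Complex.one_re, hμ]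
    norm_num
  | weightZero =>
    simp only [Complex.div_ofNat_re, hμ]
    norm_num
  | weightZeroX =>
    simp only [Complex.div_ofNat_re, Complex.add_re, Complex.one_re, hμ]
    norm_num

/-- `re β(t) ≥ ½` for a complex tag with `re μ₁ = 0`. [folklore] -/
theorem re_complexTagExponentRec_ge (μ₁ : ℂ) (m : ℕ) (t : ComplexTag) (hμ : μ₁.re = 0) :
    1 / 2 ≤ (ComplexTag.rec (motive := fun _ => ℂ) (fun b => (μ₁ + m + 1) / 2 + b) (fun b => (μ₁ + m + 1) / 2 + b)
      (fun _ => (μ₁ + m + 1) / 2) t).re := by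
  have hm : (0 : ℝ) ≤ m := Nat.cast_nonneg m
  cases t with
  | holPow b =>
    have hb : (0 : ℝ) ≤ b := Nat.cast_nonneg b
    simp only [Complex.div_ofNat_re, Complex.add_re, Complex.natCast_re, Complex.one_re, hμ]
    linarith
  | antiPowLowest b =>
    have hb : (0 : ℝ) ≤ b := Nat.cast_nonneg b
    simp only [Complex.div_ofNat_re, Complex.add_re, Complex.natCast_re, Complex.one_re, hμ]
    linarith
  | string j =>
    simp only [Complex.div_ofNat_re, Complex.add_re, Complex.natCast_re, Complex.one_re, hμ]
    linarith

/-- **Recursor form of `rsGammaProduct_local_realTag`.** [cite: Jacquet1972GL2II, §17–§19] -/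
theorem rsGammaProduct_local_realTagRec (μ ν : ℂ) (t : RealTag) (μ' ν' : ℂ) (t' : RealTag) (hμ : μ.re = 0) (hμ' : μ'.re = 0)
    (ht : match t with
      | .discPlus k => 1 ≤ k
      | .weightOneSym κ => κ.re = 0
      | .weightZero => |ν.im| < 1 / 2
      | .weightZeroX => |ν.im| < 1 / 2)
    (ht' : match t' with
      | .discPlus k => 1 ≤ k
      | .weightOneSym κ => κ.re = 0
      | .weightZero => |ν'.im| < 1 / 2
      | .weightZeroX => |ν'.im| < 1 / 2) :
    (∀ s : ℂ, 1 < s.re → Integrable (fun x : ℝ =>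
      realShapeOf μ ν t x * conj (realShapeOf μ' ν' t' x) * ((|x| : ℝ) : ℂ) ^ (s - 2))) ∧
    ∃ (A : ℂ) (c : ℝ) (d₁ d₂ : ℕ) (a : Fin d₁ → ℂ) (b : Fin d₂ → ℂ), A ≠ 0 ∧ 0 < c ∧ (∀ j, -1 < (a j).re) ∧
      (∀ j, -1 < (b j).re) ∧ ∀ s : ℂ, 1 < s.re →
        Complex.Gammaℝ (2 * s + 2 * (RealTag.rec (motive := fun _ => ℂ) (fun k => (μ + k) / 2) (fun _ => (μ + 1) / 2) (μ / 2) (μ / 2 + 1) t +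
            conj (RealTag.rec (motive := fun _ => ℂ) (fun k => (μ' + k) / 2) (fun _ => (μ' + 1) / 2) (μ' / 2) (μ' / 2 + 1) t'))) *
          ∫ x : ℝ, realShapeOf μ ν t x * conj (realShapeOf μ' ν' t' x) * ((|x| : ℝ) : ℂ) ^ (s - 2) =
          A * (c : ℂ) ^ s * ((∏ j, Complex.Gammaℝ (s + a j)) * ∏ j, Complex.Gammaℂ (s + b j)) := by
  cases t <;> cases t' <;> exact rsGammaProduct_local_realTag μ ν _ μ' ν' _ hμ hμ' ht ht'

/-- **Recursor form of `rsGammaProduct_local_complexTag`.** [cite: Jacquet1972GL2II, §17–§19] -/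
theorem rsGammaProduct_local_complexTagRec (μ₁ : ℂ) (m : ℕ) (νa νh : ℂ) (t : ComplexTag) (μ₁' : ℂ) (m' : ℕ) (νa' νh' : ℂ)
    (t' : ComplexTag) (hμ : μ₁.re = 0) (hμ' : μ₁'.re = 0)
    (hνa : |νa.im| < (m : ℝ) / 2 + 1) (hνh : |νh.im| < (m : ℝ) / 2 + 1)
    (hνa' : |νa'.im| < (m' : ℝ) / 2 + 1) (hνh' : |νh'.im| < (m' : ℝ) / 2 + 1)
    (ht : match t with
      | .string j => νa.im = (m : ℝ) / 2 ∧ j ≤ m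
      | _ => True)
    (ht' : match t' with
      | .string j => νa'.im = (m' : ℝ) / 2 ∧ j ≤ m'
      | _ => True) :
    (∀ s : ℂ, 1 < s.re → Integrable (fun x : ℂ =>
      complexShapeOf μ₁ m νa νh t x * conj (complexShapeOf μ₁' m' νa' νh' t' x) * ((‖x‖ ^ 2 : ℝ) : ℂ) ^ (s - 2))) ∧
    ∃ (A : ℂ) (c : ℝ) (d₁ d₂ : ℕ) (a : Fin d₁ → ℂ) (b : Fin d₂ → ℂ), A ≠ 0 ∧ 0 < c ∧ (∀ j, -1 < (a j).re) ∧
      (∀ j, -1 < (b j).re) ∧ ∀ s : ℂ, 1 < s.re →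
        ((Real.pi / 2 : ℂ) * (2 : ℂ) ^ (2 * s + (2 * (ComplexTag.rec (motive := fun _ => ℂ) (fun b => (μ₁ + m + 1) / 2 + b)
            (fun b => (μ₁ + m + 1) / 2 + b) (fun _ => (μ₁ + m + 1) / 2) t +
            conj (ComplexTag.rec (motive := fun _ => ℂ) (fun b => (μ₁' + m' + 1) / 2 + b)
            (fun b => (μ₁' + m' + 1) / 2 + b) (fun _ => (μ₁' + m' + 1) / 2) t')) - 2) / 2) *
          Complex.Gammaℂ (2 * s + (2 * (ComplexTag.rec (motive := fun _ => ℂ) (fun b => (μ₁ + m + 1) / 2 + b)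
            (fun b => (μ₁ + m + 1) / 2 + b) (fun _ => (μ₁ + m + 1) / 2) t +
            conj (ComplexTag.rec (motive := fun _ => ℂ) (fun b => (μ₁' + m' + 1) / 2 + b)
            (fun b => (μ₁' + m' + 1) / 2 + b) (fun _ => (μ₁' + m' + 1) / 2) t')) - 2) / 2)) *
          ∫ x : ℂ, complexShapeOf μ₁ m νa νh t x * conj (complexShapeOf μ₁' m' νa' νh' t' x) * ((‖x‖ ^ 2 : ℝ) : ℂ) ^ (s - 2) =
          A * (c : ℂ) ^ s * ((∏ j, Complex.Gammaℝ (s + a j)) * ∏ j, Complex.Gammaℂ (s + b j)) := by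
  cases t <;> cases t' <;>
    exact rsGammaProduct_local_complexTag μ₁ m νa νh _ μ₁' m' νa' νh' _ hμ hμ' hνa hνh hνa' hνh' ht ht'

/-! ### 2. The global identity `T(s) · M(s) = A c^s ∏ Γ_ℝ(s + a_j) ∏ Γ_ℂ(s + b_j)` -/

set_option maxHeartbeats 1600000 in
/-- **The Gamma bookkeeping of the archimedean `GL₂ × GL₂` Rankin–Selberg integral for a pair of tagged test
vectors.** Data: at every real place `w` the central scalars `μ_w, μ'_w` (purely imaginary), Bessel parameters
`ν_w, ν'_w` and tags `t_w, t'_w` of the two vectors with the unitarity bounds (`ArchUnitarityBoundsGL2Real`), at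
every complex place the central scalars `μ₁`, minimal types `m`, Bessel parameters `ν^a, ν^h` and tags with the
unitarity bounds (`ArchUnitarityBoundsGL2Complex`); the product `H(u) = C ∏_w S_{t_w}(u_w) conj S'_{t'_w}(u_w) ·
∏_w S_{t_w}(u_w) conj S'_{t'_w}(u_w)` (`C ≠ 0`) of the two factorised Kirillov functions
(`ArchKirillovFactorisationGL2`, `realShapeOf`, `complexShapeOf`); and a Tate integrand `g` which is the radial
Gaussian monomial of exponents `p_w = 2(β(t_w) + conj β(t'_w))` (real) and `q_w = 2(β(t_w) + conj β(t'_w)) - 2`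
(complex) — the degree of the weight polynomial (`p + p'`, resp. `n + n'`) plus the central exponents. Then for
any Haar measures `μ_c` on `K_∞ˣ` and `μ_A'` on `K_∞ˣ = (Fin 1 → K_∞ˣ)`:
`(∫ g N^{2s} dμ_c) · ∫ H(y' 0) N(y' 0)^{s-1} dμ_A'(y') = A c^s ∏_j Γ_ℝ(s + a_j) ∏_j Γ_ℂ(s + b_j)` on `re s > 1`
with `A ≠ 0`, `c > 0`, `re a_j, re b_j > -1` (Tate's factor `ArchRankinSelbergTateFactorGL2`, Fubini over
`K_∞ˣ` `integrable_and_integral_units_prod_mul_norm_cpow`, and the local bookkeeping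
`rsGammaProduct_local_realTag` / `rsGammaProduct_local_complexTag`). This is the analytic half
(Humphries–Jo (2024), Thm. 5.6 with Prop. 5.8: `Ψ = L(s, π_ur × σ_ur)`, a Gamma product) of the `K_∞`-average
Gamma identity of `HumphriesJo2024_archRankinSelberg_testVector_two_gammaIdentity_of_kAverage`.
[cite: HumphriesJo2024, Thm. 5.6, Prop. 5.8] [cite: Jacquet1972GL2II, §17–§19] -/
theorem rsGammaProduct_archRankinSelberg_tagged [mU : MeasurableSpace ((mixedSpace K)ˣ)] [hmU : BorelSpace ((mixedSpace K)ˣ)]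
    (μc : Measure (mixedSpace K)ˣ) [IsHaarMeasure μc]
    (μA' : Measure (Fin 1 → (mixedSpace K)ˣ)) [IsHaarMeasure μA']
    (μR νR : {w : InfinitePlace K // IsReal w} → ℂ) (tR : {w : InfinitePlace K // IsReal w} → RealTag)
    (μR' νR' : {w : InfinitePlace K // IsReal w} → ℂ) (tR' : {w : InfinitePlace K // IsReal w} → RealTag)
    (hμR : ∀ w, (μR w).re = 0) (hμR' : ∀ w, (μR' w).re = 0)
    (htR : ∀ w, match tR w with
      | .discPlus k => 1 ≤ k
      | .weightOneSym κ => κ.re = 0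
      | .weightZero => |(νR w).im| < 1 / 2
      | .weightZeroX => |(νR w).im| < 1 / 2)
    (htR' : ∀ w, match tR' w with
      | .discPlus k => 1 ≤ k
      | .weightOneSym κ => κ.re = 0
      | .weightZero => |(νR' w).im| < 1 / 2
      | .weightZeroX => |(νR' w).im| < 1 / 2)
    (μC : {w : InfinitePlace K // IsComplex w} → ℂ) (mC : {w : InfinitePlace K // IsComplex w} → ℕ)
    (νa νh : {w : InfinitePlace K // IsComplex w} → ℂ) (tC : {w : InfinitePlace K // IsComplex w} → ComplexTag)
    (μC' : {w : InfinitePlace K // IsComplex w} → ℂ) (mC' : {w : InfinitePlace K // IsComplex w} → ℕ)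
    (νa' νh' : {w : InfinitePlace K // IsComplex w} → ℂ) (tC' : {w : InfinitePlace K // IsComplex w} → ComplexTag)
    (hμC : ∀ w, (μC w).re = 0) (hμC' : ∀ w, (μC' w).re = 0)
    (hνa : ∀ w, |(νa w).im| < (mC w : ℝ) / 2 + 1) (hνh : ∀ w, |(νh w).im| < (mC w : ℝ) / 2 + 1)
    (hνa' : ∀ w, |(νa' w).im| < (mC' w : ℝ) / 2 + 1) (hνh' : ∀ w, |(νh' w).im| < (mC' w : ℝ) / 2 + 1)
    (htC : ∀ w, match tC w with
      | .string j => (νa w).im = (mC w : ℝ) / 2 ∧ j ≤ mC w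
      | _ => True)
    (htC' : ∀ w, match tC' w with
      | .string j => (νa' w).im = (mC' w : ℝ) / 2 ∧ j ≤ mC' w
      | _ => True)
    (p : {w : InfinitePlace K // IsReal w} → ℂ)
    (hp : ∀ w, p w = 2 * (RealTag.rec (motive := fun _ => ℂ) (fun k => (μR w + k) / 2) (fun _ => (μR w + 1) / 2) (μR w / 2) (μR w / 2 + 1) (tR w) +
      conj (RealTag.rec (motive := fun _ => ℂ) (fun k => (μR' w + k) / 2) (fun _ => (μR' w + 1) / 2) (μR' w / 2) (μR' w / 2 + 1) (tR' w))))
    (q : {w : InfinitePlace K // IsComplex w} → ℂ)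
    (hq : ∀ w, q w = 2 * (ComplexTag.rec (motive := fun _ => ℂ) (fun b => (μC w + mC w + 1) / 2 + b)
        (fun b => (μC w + mC w + 1) / 2 + b) (fun _ => (μC w + mC w + 1) / 2) (tC w) +
      conj (ComplexTag.rec (motive := fun _ => ℂ) (fun b => (μC' w + mC' w + 1) / 2 + b)
        (fun b => (μC' w + mC' w + 1) / 2 + b) (fun _ => (μC' w + mC' w + 1) / 2) (tC' w))) - 2)
    (g : (mixedSpace K)ˣ → ℂ)
    (hg : ∀ c : (mixedSpace K)ˣ, g c =
      (∏ w, (((|((c : (mixedSpace K)ˣ) : mixedSpace K).1 w| : ℝ) : ℂ)) ^ (p w) *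
        (Real.exp (-(Real.pi * (((c : (mixedSpace K)ˣ) : mixedSpace K).1 w) ^ 2)) : ℂ)) *
      ∏ w, (((‖((c : (mixedSpace K)ˣ) : mixedSpace K).2 w‖ : ℝ) : ℂ) ^ (q w) *
        (Real.exp (-(Real.pi * ‖((c : (mixedSpace K)ˣ) : mixedSpace K).2 w‖ ^ 2)) : ℂ)))
    (C : ℂ) (hC : C ≠ 0) (H : (mixedSpace K)ˣ → ℂ)
    (hH : ∀ u : (mixedSpace K)ˣ, H u = C * ((∏ w, realShapeOf (μR w) (νR w) (tR w) (((u : (mixedSpace K)ˣ) : mixedSpace K).1 w) *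
        conj (realShapeOf (μR' w) (νR' w) (tR' w) (((u : (mixedSpace K)ˣ) : mixedSpace K).1 w))) *
      ∏ w, complexShapeOf (μC w) (mC w) (νa w) (νh w) (tC w) (((u : (mixedSpace K)ˣ) : mixedSpace K).2 w) *
        conj (complexShapeOf (μC' w) (mC' w) (νa' w) (νh' w) (tC' w) (((u : (mixedSpace K)ˣ) : mixedSpace K).2 w)))) :
    ∃ (A : ℂ) (c : ℝ) (d₁ d₂ : ℕ) (a : Fin d₁ → ℂ) (b : Fin d₂ → ℂ), A ≠ 0 ∧ 0 < c ∧ (∀ j, -1 < (a j).re) ∧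
      (∀ j, -1 < (b j).re) ∧ ∀ s : ℂ, 1 < s.re →
        (∫ cc, g cc * ((mixedEmbedding.norm ((cc : (mixedSpace K)ˣ) : mixedSpace K) : ℝ) : ℂ) ^ (2 * s) ∂μc) *
          ∫ y' : Fin 1 → (mixedSpace K)ˣ, H (y' 0) *
            ((mixedEmbedding.norm ((y' 0 : (mixedSpace K)ˣ) : mixedSpace K) : ℝ) : ℂ) ^ (s - 1) ∂μA' =
          A * (c : ℂ) ^ s * ((∏ j, Complex.Gammaℝ (s + a j)) * ∏ j, Complex.Gammaℂ (s + b j)) := by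
  -- Mathlib's (Borel) measurable structure on `K_∞ˣ`
  have hmU' : mU = Units.instMeasurableSpace := by
    rw [hmU.measurable_eq]
    exact (Literature.MeasureTheory.Group.Units.borelSpace_of_isOpenEmbedding (A := mixedSpace K)).measurable_eq.symm
  subst hmU'
  -- Tate's factor
  obtain ⟨cμ, hcμ, hT⟩ := tateFactor_units_eq K μc
  -- transport `μ_A'` to `K_∞ˣ`
  set eU : (Fin 1 → (mixedSpace K)ˣ) ≃ᵐ (mixedSpace K)ˣ := MeasurableEquiv.funUnique (Fin 1) (mixedSpace K)ˣ with heU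
  haveI hHaar : IsHaarMeasure (μA'.map eU) := by
    have hco : (⇑eU : (Fin 1 → (mixedSpace K)ˣ) → (mixedSpace K)ˣ) = ⇑(MulEquiv.funUnique (Fin 1) (mixedSpace K)ˣ) := rfl
    rw [hco]
    exact MulEquiv.isHaarMeasure_map μA' _ (continuous_apply _) (continuous_pi fun _ => continuous_id)
  obtain ⟨cA, hcA, hM⟩ := integrable_and_integral_units_prod_mul_norm_cpow K (μA'.map eU)
  -- the one-variable factors
  set F : {w : InfinitePlace K // IsReal w} → ℝ → ℂ := fun w t =>
    realShapeOf (μR w) (νR w) (tR w) t * conj (realShapeOf (μR' w) (νR' w) (tR' w) t) with hFdef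
  set G : {w : InfinitePlace K // IsComplex w} → ℂ → ℂ := fun w z =>
    complexShapeOf (μC w) (mC w) (νa w) (νh w) (tC w) z * conj (complexShapeOf (μC' w) (mC' w) (νa' w) (νh' w) (tC' w) z) with hGdef
  have hFm : ∀ w, Measurable (F w) := fun w =>
    (measurable_realShapeOf _ _ _).mul (Complex.continuous_conj.measurable.comp (measurable_realShapeOf _ _ _))
  have hGm : ∀ w, Measurable (G w) := fun w =>
    (measurable_complexShapeOf _ _ _ _ _).mul (Complex.continuous_conj.measurable.comp (measurable_complexShapeOf _ _ _ _ _))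
  -- the local bookkeeping
  have hR := fun w => rsGammaProduct_local_realTagRec (μR w) (νR w) (tR w) (μR' w) (νR' w) (tR' w) (hμR w) (hμR' w) (htR w) (htR' w)
  have hX := fun w => rsGammaProduct_local_complexTagRec (μC w) (mC w) (νa w) (νh w) (tC w) (μC' w) (mC' w) (νa' w) (νh' w) (tC' w)
    (hμC w) (hμC' w) (hνa w) (hνh w) (hνa' w) (hνh' w) (htC w) (htC' w)
  -- the Gamma product
  have hconst : ((cμ : ℂ) * cA * C) ≠ 0 :=
    mul_ne_zero (mul_ne_zero (Complex.ofReal_ne_zero.mpr hcμ.ne') (Complex.ofReal_ne_zero.mpr hcA.ne')) hC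
  refine rsGammaProduct_congr (rsGammaProduct_mul (rsGammaProduct_mul (rsGammaProduct_const hconst)
    (rsGammaProduct_finset_prod Finset.univ fun w _ => (hR w).2))
    (rsGammaProduct_finset_prod Finset.univ fun w _ => (hX w).2)) fun s hs => ?_
  -- ### the identity at `s`
  -- Tate's factor
  have hp0 : ∀ w, 0 < (2 * s + p w).re := fun w => by
    have h := re_realTagExponentRec_nonneg (μR w) (νR w) (tR w) (hμR w) (htR w)
    have h' := re_realTagExponentRec_nonneg (μR' w) (νR' w) (tR' w) (hμR' w) (htR' w)
    rw [hp w]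
    simp only [Complex.add_re, Complex.mul_re, Complex.re_ofNat, Complex.im_ofNat, zero_mul, sub_zero, Complex.conj_re] at h h' ⊢
    nlinarith
  have hq0 : ∀ w, 0 < (2 * s + q w / 2).re := fun w => by
    have h := re_complexTagExponentRec_ge (μC w) (mC w) (tC w) (hμC w)
    have h' := re_complexTagExponentRec_ge (μC' w) (mC' w) (tC' w) (hμC' w)
    rw [hq w]
    simp only [Complex.add_re, Complex.sub_re, Complex.mul_re, Complex.re_ofNat, Complex.im_ofNat, zero_mul, sub_zero,
      Complex.conj_re, Complex.div_ofNat_re] at h h' ⊢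
    nlinarith
  rw [hT p q g s hp0 hq0 hg]
  -- the Mellin transform: to `K_∞ˣ`
  have hM1 : ∫ y' : Fin 1 → (mixedSpace K)ˣ, H (y' 0) *
      ((mixedEmbedding.norm ((y' 0 : (mixedSpace K)ˣ) : mixedSpace K) : ℝ) : ℂ) ^ (s - 1) ∂μA' =
      ∫ u : (mixedSpace K)ˣ, H u * ((mixedEmbedding.norm ((u : (mixedSpace K)ˣ) : mixedSpace K) : ℝ) : ℂ) ^ (s - 1) ∂(μA'.map eU) := by
    rw [integral_map_equiv eU]
    rfl
  rw [hM1]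
  -- Fubini over the places
  have e1 : (s - 1 / 2 - 3 / 2 : ℂ) = s - 2 := by ring
  have e2 : (s - 1 / 2 - 1 / 2 : ℂ) = s - 1 := by ring
  have hFi : ∀ w, Integrable fun t : ℝ => F w t * ((|t| : ℝ) : ℂ) ^ (s - 1 / 2 - 3 / 2) := fun w => by
    rw [e1]; exact (hR w).1 s hs
  have hGi : ∀ w, Integrable fun z : ℂ => G w z * ((‖z‖ ^ 2 : ℝ) : ℂ) ^ (s - 1 / 2 - 3 / 2) := fun w => by
    rw [e1]; exact (hX w).1 s hs
  obtain ⟨-, hval⟩ := hM F G (s - 1 / 2) hFm hGm hFi hGi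
  rw [e1, e2] at hval
  have hM2 : ∫ u : (mixedSpace K)ˣ, H u * ((mixedEmbedding.norm ((u : (mixedSpace K)ˣ) : mixedSpace K) : ℝ) : ℂ) ^ (s - 1) ∂(μA'.map eU) =
      C * (cA * ((∏ w, ∫ t : ℝ, F w t * ((|t| : ℝ) : ℂ) ^ (s - 2)) * ∏ w, ∫ z : ℂ, G w z * ((‖z‖ ^ 2 : ℝ) : ℂ) ^ (s - 2))) := by
    rw [← hval, ← integral_const_mul]
    refine integral_congr_ae (Eventually.of_forall fun u => ?_)
    simp only []
    rw [hH u]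
    ring
  rw [hM2]
  simp only [hp, hq, hFdef, hGdef, Finset.prod_mul_distrib]
  ring


end Literature.NumberTheory.Automorphic
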